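import Literature.AlgebraicGeometry.HodgeTheory.PolarizedLimitMixedHodgeStructureHom
import HarnessLib

/-!
# The Tate twist of a polarized limit mixed Hodge structure; `Q♭ : L ⥲ L^∨(−k)` is a polarized isomorphism

For the tree's one-variable polarized nilpotent orbits `PolarizedLimitMixedHodgeStructure V k` (`L = (W, F, N, Q)`,
Cattani–El Zein–Griffiths–Lê Def. 7.5.9 = Balnojan–Hertling Def. 3.3 (c)):
* §1 `cast` — re-indexing the weight along `k = k′` (as the tree's `LimitMixedHodgeStructure.cast`).
* §2 **`tateTwist L j : PolarizedLimitMixedHodgeStructure V (k − 2j)`** — the Tate twist `L(j) = (W[2j], F[j], N)`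
  of the tree's `LimitMixedHodgeStructure.tateTwist` (Cattani et al. Ex. 3.2.23 (4): "`W_{2a} ⊗ H(W_b) ≅
  (H(W))(a)_{b+2a}`"), polarized by THE SAME form `Q`: `(−1)^{k−2j} = (−1)^k`, `Q(F^{p+j}, F^{k−2j+1−p+j}) =
  Q(F^{p+j}, F^{k+1−(p+j)}) = 0`, and `I^{a,b}(L(j)) = I^{a+j,b+j}(L)` (`deligneI_tateTwist`) with
  `i^{a−b} = i^{(a+j)−(b+j)}`.
* §3 `dualTwist L = L^∨(−k)` (weight `k`), and **`comapEquiv_qFlatEquiv_symm : L.comapEquiv Q♭⁻¹ = L^∨(−k)`**: the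
  polarization map `Q♭ : V ⥲ V^∨`, `x ↦ Q(x, ·)`, transports `L = (W, F, N, Q)` EXACTLY onto `L^∨(−k) =
  ((W_{2k−1−r})^⊥, (F^{k+1−p})^⊥, −ᵗN, Q^∨)` — i.e. `Q♭` is an isomorphism of POLARIZED limit mixed Hodge structures
  (the tree's `toDualHom`/`ofDualHom` is the isomorphism of the underlying limit mixed Hodge structures, Deligne's
  reading of a polarization as a morphism `L → L^∨(−k)`; `Q^∨(Q♭x, Q♭y) = Q(x, y)` adds the forms).
Everything is proved; definitions with bodies (`cast`, `tateTwist`, `dualTwist`); no instance, no named fact.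

## References
* [CattaniElZeinGriffithsLe2014] E. Cattani et al. (eds.), *Hodge Theory* (2014): Ex. 3.2.23 (4) (p. 163), Def. 7.5.4
  (p. 304), Def. 7.5.9 (p. 305), §8.3.2.4 (p. 361).
* [Deligne1982HodgeCycles] P. Deligne, *Hodge cycles on abelian varieties*, LNM 900, I, proof of Prop. 3.6
  (a polarization as a morphism to the dual twist).
* [BalnojanHertling2018] S. Balnojan, C. Hertling, Bull. Braz. Math. Soc. 50 (2019), Def. 3.3 (c), Lemma 3.2 (b).
-/

noncomputable section

open scoped TensorProduct

namespace Literature.AlgebraicGeometry.HodgeTheory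

open Motives
open Motives.HodgeStructure (conj)

universe u

variable {V : Type u} [AddCommGroup V] [Module ℚ V] [FiniteDimensional ℚ V] {k k' : ℤ}

namespace PolarizedLimitMixedHodgeStructure

/-! ## §1 Re-indexing the weight -/

/-- Transport of a polarized limit mixed Hodge structure along an equality of weights `k = k′` (same `W`, `F`,
`N`, `Q`). [cite: CattaniElZeinGriffithsLe2014, Def. 7.5.9 (2)] -/
def cast (L : PolarizedLimitMixedHodgeStructure V k) (h : k = k') : PolarizedLimitMixedHodgeStructure V k' :=
  h ▸ L

/-- `cast` on the underlying limit mixed Hodge structure is the tree's `LimitMixedHodgeStructure.cast`.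
[cite: CattaniElZeinGriffithsLe2014, Def. 7.5.9 (2)] -/
@[simp]
theorem cast_toLimitMixedHodgeStructure (L : PolarizedLimitMixedHodgeStructure V k) (h : k = k') :
    (L.cast h).toLimitMixedHodgeStructure = L.toLimitMixedHodgeStructure.cast h := by
  subst h
  rfl

/-- `cast` keeps `Q`. [cite: CattaniElZeinGriffithsLe2014, Def. 7.5.9] -/
@[simp]
theorem cast_Q (L : PolarizedLimitMixedHodgeStructure V k) (h : k = k') : (L.cast h).Q = L.Q := by
  subst h
  rfl

/-! ## §2 The Tate twist -/

variable (L : PolarizedLimitMixedHodgeStructure V k)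

/-- `i^{a+j}·(i^{b+j})⁻¹ = i^a·(i^b)⁻¹`. [folklore] -/
private theorem I_zpow_shift (a b j : ℤ) :
    Complex.I ^ (a + j) * (Complex.I ^ (b + j))⁻¹ = Complex.I ^ a * (Complex.I ^ b)⁻¹ := by
  rw [zpow_add₀ Complex.I_ne_zero, zpow_add₀ Complex.I_ne_zero, mul_inv, mul_mul_mul_comm,
    mul_inv_cancel₀ (zpow_ne_zero j Complex.I_ne_zero), mul_one]

/-- The first bilinear relation of the twist: `Q(F^{p+j}, F^{(k−2j)+1−p+j}) = Q(F^{p+j}, F^{k+1−(p+j)}) = 0`.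
[cite: CattaniElZeinGriffithsLe2014, Def. 7.5.9 (3) and Ex. 3.2.23 (4)] -/
theorem form_F_eq_zero_tateTwist (j p : ℤ) (x : ℂ ⊗[ℚ] V)
    (hx : x ∈ (L.toLimitMixedHodgeStructure.tateTwist j).F p) (y : ℂ ⊗[ℚ] V)
    (hy : y ∈ (L.toLimitMixedHodgeStructure.tateTwist j).F (k - 2 * j + 1 - p)) : L.Q.baseChange ℂ x y = 0 := by
  rw [LimitMixedHodgeStructure.tateTwist_F] at hx hy
  exact L.form_F_eq_zero (p + j) x hx y (by rwa [show k + 1 - (p + j) = k - 2 * j + 1 - p + j by ring])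

/-- The positivity (iv)(β) of the twist in vector form: `I^{a,b}(L(j)) = I^{a+j,b+j}(L)` and `i^{a−b} = i^{(a+j)−(b+j)}`.
[cite: CattaniElZeinGriffithsLe2014, Def. 7.5.9 (4) and Ex. 3.2.23 (4)] [cite: BalnojanHertling2018, Def. 3.3 (c) (iv)(β)] -/
theorem pos_deligneI_tateTwist (j : ℤ) (l : ℕ) (a b : ℤ) (hab : a + b = k - 2 * j + l) (v : ℂ ⊗[ℚ] V)
    (hv : v ∈ (L.toLimitMixedHodgeStructure.tateTwist j).toMixedHodgeStructure.deligneI a b)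
    (hN : ((L.toLimitMixedHodgeStructure.tateTwist j).N ^ (l + 1)).baseChange ℂ v = 0) (h0 : v ≠ 0) :
    ∃ r : ℝ, 0 < r ∧ Complex.I ^ a * (Complex.I ^ b)⁻¹ *
      L.Q.baseChange ℂ v (((L.toLimitMixedHodgeStructure.tateTwist j).N ^ l).baseChange ℂ (conj v)) = r := by
  rw [LimitMixedHodgeStructure.tateTwist_toMixedHodgeStructure, MixedHodgeStructure.deligneI_tateTwist] at hv
  rw [LimitMixedHodgeStructure.tateTwist_N] at hN ⊢
  obtain ⟨r, hr, hval⟩ := L.pos_deligneI_of_pow_N_eq_zero (a := a + j) (b := b + j) (by omega) hv hN h0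
  exact ⟨r, hr, by rw [← hval, I_zpow_shift]⟩

/-- **The Tate twist `L(j) = (W[2j], F[j], N, Q)` of a polarized limit mixed Hodge structure of weight `k` is a
polarized limit mixed Hodge structure of weight `k − 2j`, with the same form `Q`** (`(−1)^{k−2j} = (−1)^k`;
the underlying limit mixed Hodge structure is the tree's `LimitMixedHodgeStructure.tateTwist`).
[cite: CattaniElZeinGriffithsLe2014, Ex. 3.2.23 (4) (p. 163) and Def. 7.5.9 (p. 305)] [cite: BalnojanHertling2018, Def. 3.3 (c)] -/
def tateTwist (j : ℤ) : PolarizedLimitMixedHodgeStructure V (k - 2 * j) :=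
  (L.toLimitMixedHodgeStructure.tateTwist j).toPolarized L.Q L.nondegenerate_Q
    (by rw [L.flip_Q, Int.negOnePow_sub, Int.negOnePow_two_mul, mul_one]) L.skew_N (L.form_F_eq_zero_tateTwist j)
    (L.pos_deligneI_tateTwist j)

/-- The underlying limit mixed Hodge structure of `L(j)` is `LimitMixedHodgeStructure.tateTwist` (`W_i = W_{i+2j}`,
`F^p = F^{p+j}`, same `N`). [cite: CattaniElZeinGriffithsLe2014, Ex. 3.2.23 (4)] -/
@[simp]
theorem tateTwist_toLimitMixedHodgeStructure (j : ℤ) :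
    (L.tateTwist j).toLimitMixedHodgeStructure = L.toLimitMixedHodgeStructure.tateTwist j := rfl

/-- The twist keeps the form `Q`. [cite: CattaniElZeinGriffithsLe2014, Def. 7.5.9] -/
@[simp]
theorem tateTwist_Q (j : ℤ) : (L.tateTwist j).Q = L.Q := rfl

/-! ## §3 `L^∨(−k)` and the polarized isomorphism `Q♭ : L ⥲ L^∨(−k)` -/

/-- **`L^∨(−k)`**, a polarized limit mixed Hodge structure of weight `k` on `V^∨` (`(W_{2k−1−r})^⊥, (F^{k+1−p})^⊥,
−ᵗN`, form `Q^∨`) — the target of the polarization map `Q♭`. [cite: Deligne1982HodgeCycles, I Prop. 3.6 (proof)]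
[cite: CattaniElZeinGriffithsLe2014, Def. 7.5.4 (p. 304) and Ex. 3.2.23 (4)] -/
def dualTwist : PolarizedLimitMixedHodgeStructure (Module.Dual ℚ V) k :=
  (L.dual.tateTwist (-k)).cast (Motives.HodgeStructure.dual_tateTwist_weight k)

/-- The underlying limit mixed Hodge structure of `L^∨(−k)` is the tree's `LimitMixedHodgeStructure.dualTwist`.
[cite: Deligne1982HodgeCycles, I Prop. 3.6 (proof)] -/
@[simp]
theorem dualTwist_toLimitMixedHodgeStructure :
    L.dualTwist.toLimitMixedHodgeStructure = L.toLimitMixedHodgeStructure.dualTwist := by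
  rw [dualTwist, cast_toLimitMixedHodgeStructure, tateTwist_toLimitMixedHodgeStructure, dual_toLimitMixedHodgeStructure]

/-- The form of `L^∨(−k)` is `Q^∨`. [cite: Deligne1982HodgeCycles, I Prop. 3.6 (proof)] -/
@[simp]
theorem dualTwist_Q : L.dualTwist.Q = L.dualForm := by
  rw [dualTwist, cast_Q, tateTwist_Q, dual_Q]

/-- `(Q♭)_ℂ ∘ (Q♭⁻¹)_ℂ = 1`. [folklore] -/
private theorem qFlat_baseChange_symm_baseChange (ξ : ℂ ⊗[ℚ] Module.Dual ℚ V) :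
    L.qFlat.baseChange ℂ (((L.qFlatEquiv.symm : Module.Dual ℚ V →ₗ[ℚ] V)).baseChange ℂ ξ) = ξ := by
  have h : L.qFlat ∘ₗ (L.qFlatEquiv.symm : Module.Dual ℚ V →ₗ[ℚ] V) = LinearMap.id :=
    LinearMap.ext fun ξ => L.qFlat_qFlatEquiv_symm ξ
  rw [← LinearMap.comp_apply, ← LinearMap.baseChange_comp, h, LinearMap.baseChange_id, LinearMap.id_apply]

/-- `(Q♭⁻¹)_ℂ ∘ (Q♭)_ℂ = 1`. [folklore] -/
private theorem symm_baseChange_qFlat_baseChange (x : ℂ ⊗[ℚ] V) :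
    ((L.qFlatEquiv.symm : Module.Dual ℚ V →ₗ[ℚ] V)).baseChange ℂ (L.qFlat.baseChange ℂ x) = x := by
  have h : (L.qFlatEquiv.symm : Module.Dual ℚ V →ₗ[ℚ] V) ∘ₗ L.qFlat = LinearMap.id :=
    LinearMap.ext fun x => L.qFlatEquiv_symm_qFlat x
  rw [← LinearMap.comp_apply, ← LinearMap.baseChange_comp, h, LinearMap.baseChange_id, LinearMap.id_apply]

/-- `Q♭` carries `F^p(L)` onto the transported filtration: `(Q♭⁻¹)_ℂ⁻¹ F^p = (Q♭)_ℂ F^p = F^p(V^∨(−k))`.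
[cite: CattaniElZeinGriffithsLe2014, Thm. 3.2.18] -/
theorem comapEquiv_qFlatEquiv_symm_F (p : ℤ) :
    (L.toLimitMixedHodgeStructure.comapEquiv L.qFlatEquiv.symm).F p = L.toLimitMixedHodgeStructure.dualTwist.F p := by
  rw [← map_toDualHom_F, toDualHom_toLinearMap, LimitMixedHodgeStructure.comapEquiv_toMixedHodgeStructure,
    MixedHodgeStructure.comapEquiv_F]
  ext ξ
  rw [Submodule.mem_comap, Submodule.mem_map]
  constructor
  · intro h
    exact ⟨_, h, L.qFlat_baseChange_symm_baseChange ξ⟩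
  · rintro ⟨x, hx, rfl⟩
    rwa [symm_baseChange_qFlat_baseChange]

/-- `Q♭ N Q♭⁻¹ = −ᵗN`. [cite: BalnojanHertling2018, Lemma 3.2 (hypothesis "N an infinitesimal isometry")] -/
theorem comapEquiv_qFlatEquiv_symm_N :
    (L.toLimitMixedHodgeStructure.comapEquiv L.qFlatEquiv.symm).N = L.toLimitMixedHodgeStructure.dualTwist.N := by
  refine LinearMap.ext fun ξ => ?_
  obtain ⟨x, rfl⟩ := L.toDualHom_bijective.2 ξ
  rw [toDualHom_toLinearMap, LimitMixedHodgeStructure.comapEquiv_N_apply, LinearEquiv.symm_symm, qFlatEquiv_symm_qFlat,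
    qFlatEquiv_apply, LimitMixedHodgeStructure.dualTwist_N, ← LimitMixedHodgeStructure.dual_N, dual_N_qFlat]

/-- **The polarization map `Q♭ : V ⥲ V^∨` is an isomorphism of POLARIZED limit mixed Hodge structures
`L ⥲ L^∨(−k)`**: transporting `L = (W, F, N, Q)` along `Q♭⁻¹ : V^∨ ⥲ V` gives exactly
`L^∨(−k) = ((W_{2k−1−r})^⊥, (F^{k+1−p})^⊥, −ᵗN, Q^∨)` — `Q♭(W_m) = (W_{2k−1−m})^⊥` (Lemma 3.2 (b)),
`(Q♭)_ℂ F^p = (F^{k+1−p})^⊥` (the first bilinear relation with equality), `Q♭ N = (−ᵗN) Q♭` (`N ∈ 𝔤`),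
`Q^∨(Q♭x, Q♭y) = Q(x, y)`. [cite: Deligne1982HodgeCycles, I Prop. 3.6 (proof)]
[cite: BalnojanHertling2018, Lemma 3.2 (b) and Def. 3.3 (c)] [cite: CattaniElZeinGriffithsLe2014, Def. 7.5.4 and Thm. 3.2.18] -/
theorem comapEquiv_qFlatEquiv_symm : L.comapEquiv L.qFlatEquiv.symm = L.dualTwist :=
  eq_of_toLimitMixedHodgeStructure_eq_of_Q_eq
    (by
      rw [comapEquiv_toLimitMixedHodgeStructure, dualTwist_toLimitMixedHodgeStructure]
      exact LimitMixedHodgeStructure.ext_of_F_N (funext L.comapEquiv_qFlatEquiv_symm_F) L.comapEquiv_qFlatEquiv_symm_N)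
    (by rw [comapEquiv_Q, dualTwist_Q]; rfl)

end PolarizedLimitMixedHodgeStructure

end Literature.AlgebraicGeometry.HodgeTheory

end
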